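import Literature.Probability.RandomPlanarGeometry.BrownianBridgeValueLaw
import Literature.Probability.RandomPlanarGeometry.BrownianLoopMeasureSimilarity
import Mathlib.MeasureTheory.Constructions.UnitInterval
import HarnessLib

/-!
# Calculus for splitting a Brownian loop: the planar heat kernel and two changes of variables

Elementary identities behind the Chapman–Kolmogorov equation for the Brownian bridge/loop
measures (Lawler, *Conformally Invariant Processes in the Plane* (2005), §5.2:
"`μ_D(z, w; s + t) = ∫_D [μ_D(z, z'; s) ⊕ μ_D(z', w; t)] dA(z')`", with `|μ(z, w; t)| =
p(z, w; t)` the heat kernel), used to decompose the rooted loop measure `dt/(2πt²) × μ^#`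
marked at a uniform time `u ∈ [0,1]` into two independent bridges through the marked point:

* `BrownianLoop.heat s x` — the planar heat kernel `p_s(0, x) = (2πs)⁻¹ e^{−|x|²/2s}` in `ℝ≥0∞`
  (product of the two Gaussian densities; `0` for `s ≤ 0`); `heat_eq`, `heat_neg`,
  `heat_scale` (`p_v(y) = t · p_{tv}(√t y)`), and the **semigroup identity behind the
  marking**, `timeDensity_mul_heat`: `(2π t²)⁻¹ p_{ss'/t}(x) = p_s(x) p_{s'}(x) / t`,
  `t = s + s'`;
* `lintegral_heat_affine` — `∫ p_v(y) G(z + √t y) dy = ∫ p_{tv}(w − z) G(w) dw`;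
* `lintegral_Ioi_unitInterval_split` — `∫_{t>0} ∫_{u∈[0,1]} t · g(tu, t(1−u)) du dt =
  ∫_{s>0} ∫_{s'>0} g(s, s') ds' ds` (duration and uniform mark `↦` the two durations).

## References

* G. F. Lawler, *Conformally Invariant Processes in the Plane*, AMS (2005), §5.2.
-/

noncomputable section

open Set MeasureTheory ProbabilityTheory unitInterval
open scoped unitInterval NNReal ENNReal Real

namespace Literature.Probability.RandomPlanarGeometry

namespace BrownianLoop

/-! ### The planar heat kernel -/

/-- **The planar heat kernel** `p_s(0, x) = (2πs)⁻¹ e^{−|x|²/(2s)}` as the product of the two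
centred Gaussian densities of variance `s` (junk `0` for `s ≤ 0`) ([Lawler] §2.4/§5.2:
`|μ(z, w; t)| = p(z, w; t)`). [cite: Lawler2005ConformallyInvariant, §5.2] -/
def heat (s : ℝ) (x : ℂ) : ℝ≥0∞ := gaussianPDF 0 s.toNNReal x.re * gaussianPDF 0 s.toNNReal x.im

/-- `heat` is jointly measurable. [folklore] -/
theorem measurable_heat : Measurable fun p : ℝ × ℂ ↦ heat p.1 p.2 := by
  have h1 : Measurable fun p : ℝ × ℝ ↦ gaussianPDFReal 0 p.1.toNNReal p.2 := by
    unfold gaussianPDFReal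
    fun_prop
  unfold heat gaussianPDF
  exact (ENNReal.measurable_ofReal.comp
      (h1.comp (measurable_fst.prodMk (Complex.measurable_re.comp measurable_snd)))).mul
    (ENNReal.measurable_ofReal.comp
      (h1.comp (measurable_fst.prodMk (Complex.measurable_im.comp measurable_snd))))

/-- `heat s` is measurable for each `s`. [folklore] -/
theorem measurable_heat_right (s : ℝ) : Measurable (heat s) := by
  have h := measurable_heat.comp (f := fun x : ℂ ↦ (s, x)) (measurable_const.prodMk measurable_id)
  exact h

/-- **Closed form**: `heat s x = (2πs)⁻¹ e^{−‖x‖²/(2s)}` for `s > 0`. [folklore] -/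
theorem heat_eq {s : ℝ} (hs : 0 < s) (x : ℂ) :
    heat s x = ENNReal.ofReal ((2 * π * s)⁻¹ * Real.exp (-‖x‖ ^ 2 / (2 * s))) := by
  have hpos : 0 < 2 * π * s := by positivity
  have hc : ((s.toNNReal : ℝ≥0) : ℝ) = s := Real.coe_toNNReal _ hs.le
  rw [heat, gaussianPDF, gaussianPDF, ← ENNReal.ofReal_mul (gaussianPDFReal_nonneg _ _ _)]
  congr 1
  simp only [gaussianPDFReal, hc, sub_zero]
  rw [Complex.sq_norm, Complex.normSq_apply]
  have hsq : Real.sqrt (2 * π * s) ≠ 0 := (Real.sqrt_pos.2 hpos).ne'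
  rw [show (-(x.re ^ 2) / (2 * s)) = -(x.re ^ 2 / (2 * s)) by ring,
    show (-(x.im ^ 2) / (2 * s)) = -(x.im ^ 2 / (2 * s)) by ring,
    show (-(x.re * x.re + x.im * x.im) / (2 * s)) = -(x.re ^ 2 / (2 * s)) + -(x.im ^ 2 / (2 * s)) by
      ring, Real.exp_add]
  have h2 : (Real.sqrt (2 * π * s))⁻¹ * (Real.sqrt (2 * π * s))⁻¹ = (2 * π * s)⁻¹ := by
    rw [← mul_inv, Real.mul_self_sqrt hpos.le]
  calc (Real.sqrt (2 * π * s))⁻¹ * Real.exp (-(x.re ^ 2 / (2 * s))) *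
        ((Real.sqrt (2 * π * s))⁻¹ * Real.exp (-(x.im ^ 2 / (2 * s))))
      = ((Real.sqrt (2 * π * s))⁻¹ * (Real.sqrt (2 * π * s))⁻¹) *
          (Real.exp (-(x.re ^ 2 / (2 * s))) * Real.exp (-(x.im ^ 2 / (2 * s)))) := by ring
    _ = _ := by rw [h2]

/-- `heat s = 0` for `s ≤ 0` (junk). [folklore] -/
theorem heat_of_nonpos {s : ℝ} (hs : s ≤ 0) (x : ℂ) : heat s x = 0 := by
  rw [heat, Real.toNNReal_of_nonpos hs, gaussianPDF_zero_var]
  simp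

/-- **The heat kernel is even**: `p_s(−x) = p_s(x)`. [folklore] -/
theorem heat_neg (s : ℝ) (x : ℂ) : heat s (-x) = heat s x := by
  rcases le_or_gt s 0 with hs | hs
  · rw [heat_of_nonpos hs, heat_of_nonpos hs]
  · rw [heat_eq hs, heat_eq hs, norm_neg]

/-- **Brownian scaling of the heat kernel**: `p_v(y) = t · p_{tv}(√t y)` (`t, v > 0`).
[folklore] -/
theorem heat_scale {t v : ℝ} (ht : 0 < t) (hv : 0 < v) (y : ℂ) :
    heat v y = ENNReal.ofReal t * heat (t * v) ((Real.sqrt t : ℂ) * y) := by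
  rw [heat_eq hv, heat_eq (mul_pos ht hv), ← ENNReal.ofReal_mul ht.le]
  congr 1
  have hn : ‖(Real.sqrt t : ℂ) * y‖ ^ 2 = t * ‖y‖ ^ 2 := by
    rw [norm_mul, Complex.norm_real, Real.norm_of_nonneg (Real.sqrt_nonneg _), mul_pow,
      Real.sq_sqrt ht.le]
  rw [hn]
  have e1 : -(t * ‖y‖ ^ 2) / (2 * (t * v)) = -‖y‖ ^ 2 / (2 * v) := by
    field_simp
  rw [e1]
  field_simp

/-- **The semigroup/marking identity for the heat kernel**: with `t = s + s'`,
`(2π t²)⁻¹ · p_{ss'/t}(x) = p_s(x) p_{s'}(x) / t` — the density `1/(2πt²)` of the rooted loop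
measure at a loop of duration `t` split into bridges of durations `s, s'` through a point at
displacement `x` from the root (a Gaussian of variance `ss'/t`), equals the product of the two
bridge weights `p_s(x) p_{s'}(x)` divided by `t` ([Lawler] §5.2, Chapman–Kolmogorov).
[cite: Lawler2005ConformallyInvariant, §5.2] -/
theorem timeDensity_mul_heat {s s' : ℝ} (hs : 0 < s) (hs' : 0 < s') (x : ℂ) :
    timeDensity (s + s') * heat (s * s' / (s + s')) x =
      heat s x * heat s' x / ENNReal.ofReal (s + s') := by
  have ht : 0 < s + s' := add_pos hs hs'
  have hv : 0 < s * s' / (s + s') := div_pos (mul_pos hs hs') ht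
  rw [timeDensity, heat_eq hv, heat_eq hs, heat_eq hs', ← ENNReal.ofReal_mul (by positivity),
    ← ENNReal.ofReal_mul (by positivity), ← ENNReal.ofReal_div_of_pos ht]
  congr 1
  rw [mul_mul_mul_comm, ← Real.exp_add]
  have e1 : -‖x‖ ^ 2 / (2 * s) + -‖x‖ ^ 2 / (2 * s') = -‖x‖ ^ 2 / (2 * (s * s' / (s + s'))) := by
    field_simp
    ring
  rw [e1]
  field_simp

/-! ### An affine Gaussian change of variables on `ℂ` -/

/-- **`∫ p_v(y) G(z + √t y) dy = ∫ p_{tv}(w − z) G(w) dw`** (`t, v > 0`): substituting the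
scaled and translated variable in a planar Gaussian integral (area scales by `t`, the heat
kernel by `heat_scale`). [folklore] -/
theorem lintegral_heat_affine {t v : ℝ} (ht : 0 < t) (hv : 0 < v) (z : ℂ) {G : ℂ → ℝ≥0∞}
    (hG : Measurable G) :
    ∫⁻ y, heat v y * G (z + (Real.sqrt t : ℂ) * y) = ∫⁻ w, heat (t * v) (w - z) * G w := by
  set e : ℂ → ℂ := fun y ↦ (Real.sqrt t : ℂ) * y + z with he
  have hem : Measurable e := by rw [he]; fun_prop
  have hH : Measurable fun w ↦ heat (t * v) (w - z) * G w :=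
    ((measurable_heat_right _).comp (measurable_id.sub measurable_const)).mul hG
  have hmap : (volume : Measure ℂ).map e = ENNReal.ofReal (Real.sqrt t ^ 2)⁻¹ • volume :=
    map_volume_similarity (Real.sqrt_pos.2 ht) z (fun y ↦ rfl)
  have h1 : ∫⁻ w, heat (t * v) (w - z) * G w ∂((volume : Measure ℂ).map e) =
      ∫⁻ y, heat (t * v) (e y - z) * G (e y) := lintegral_map hH hem
  rw [hmap, lintegral_smul_measure, Real.sq_sqrt ht.le] at h1
  -- `∫ H = t * ∫ H ∘ e`
  have h2 : ∫⁻ w, heat (t * v) (w - z) * G w =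
      ENNReal.ofReal t * ∫⁻ y, heat (t * v) (e y - z) * G (e y) := by
    rw [← h1, smul_eq_mul, ← mul_assoc, ← ENNReal.ofReal_mul ht.le, mul_inv_cancel₀ ht.ne',
      ENNReal.ofReal_one, one_mul]
  have hmeas : Measurable fun y ↦ heat (t * v) (e y - z) * G (e y) :=
    ((measurable_heat_right _).comp (hem.sub measurable_const)).mul (hG.comp hem)
  rw [h2, ← lintegral_const_mul (ENNReal.ofReal t) hmeas]
  refine lintegral_congr fun y ↦ ?_
  rw [heat_scale ht hv y, he]
  simp only [add_sub_cancel_right]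
  rw [add_comm]
  ring

/-! ### Duration and uniform mark `↦` the two durations -/

/-- Scaling a `lintegral` over `[0, 1]` onto `[0, t]`: `∫₀¹ t · h(tu) du = ∫₀ᵗ h(s) ds` for
`t > 0`. [folklore] -/
theorem lintegral_unitInterval_mul {t : ℝ} (ht : 0 < t) {h : ℝ → ℝ≥0∞} (hh : Measurable h) :
    ∫⁻ u : I, ENNReal.ofReal t * h (t * u) = ∫⁻ s in Ioo (0 : ℝ) t, h s := by
  -- to an integral over `Ioo 0 1 ⊆ ℝ`
  have hm1 : Measurable fun x : ℝ ↦ ENNReal.ofReal t * h (t * x) :=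
    (hh.comp (measurable_const_mul t)).const_mul _
  have hm2 : Measurable fun x : ℝ ↦ h (t * x) := hh.comp (measurable_const_mul t)
  have h0 : ∫⁻ u : I, ENNReal.ofReal t * h (t * u) =
      ∫⁻ x in Ioo (0 : ℝ) 1, ENNReal.ofReal t * h (t * x) := by
    rw [Measure.restrict_congr_set Ioo_ae_eq_Icc]
    exact measurePreserving_coe.lintegral_comp hm1
  rw [h0, lintegral_const_mul _ hm2]
  -- the linear change of variables `s = t x`
  have hcv : ∫⁻ x in Ioo (0 : ℝ) 1, h (t * x) = ENNReal.ofReal t⁻¹ * ∫⁻ s in Ioo (0 : ℝ) t, h s := by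
    have hm : Measurable fun x : ℝ ↦ t * x := measurable_const_mul t
    have e1 : (Ioo (0 : ℝ) 1) = (fun x ↦ t * x) ⁻¹' (Ioo (0 : ℝ) t) := by
      ext x
      simp only [mem_Ioo, mem_preimage]
      constructor
      · rintro ⟨h1, h2⟩; exact ⟨by positivity, by nlinarith⟩
      · rintro ⟨h1, h2⟩; exact ⟨by nlinarith, by nlinarith⟩
    rw [e1, ← lintegral_indicator (hm measurableSet_Ioo), ← lintegral_indicator measurableSet_Ioo]
    have h2 := lintegral_map_equiv (μ := (volume : Measure ℝ)) ((Ioo (0 : ℝ) t).indicator h)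
      (Homeomorph.mulLeft₀ t ht.ne').toMeasurableEquiv
    rw [Homeomorph.toMeasurableEquiv_coe, Homeomorph.coe_mulLeft₀, Real.map_volume_mul_left ht.ne',
      lintegral_smul_measure, smul_eq_mul, abs_of_pos (inv_pos.2 ht)] at h2
    rw [h2]
    refine lintegral_congr fun x ↦ ?_
    simp only [indicator, mem_preimage]
  rw [hcv, ← mul_assoc, ← ENNReal.ofReal_mul ht.le, mul_inv_cancel₀ ht.ne', ENNReal.ofReal_one,
    one_mul]

/-- **Duration and uniform mark `↦` the two durations**: for measurable `g ≥ 0` on `ℝ × ℝ`,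
`∫_{t>0} ∫_{u ∈ [0,1]} t · g(tu, t(1−u)) du dt = ∫_{s>0} ∫_{s'>0} g(s, s') ds' ds` (the loop of
duration `t` with a uniform mark at time `tu` has pieces of durations `s = tu`, `s' = t − s`;
`t du dt = ds ds'`). [folklore] -/
theorem lintegral_Ioi_unitInterval_split {g : ℝ × ℝ → ℝ≥0∞} (hg : Measurable g) :
    ∫⁻ t in Ioi (0 : ℝ), ∫⁻ u : I, ENNReal.ofReal t * g (t * u, t * (1 - u)) =
      ∫⁻ s in Ioi (0 : ℝ), ∫⁻ s' in Ioi (0 : ℝ), g (s, s') := by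
  -- inner change of variables `s = tu` for each `t > 0`
  have step1 : ∫⁻ t in Ioi (0 : ℝ), ∫⁻ u : I, ENNReal.ofReal t * g (t * u, t * (1 - u)) =
      ∫⁻ t in Ioi (0 : ℝ), ∫⁻ s in Ioo (0 : ℝ) t, g (s, t - s) := by
    refine setLIntegral_congr_fun measurableSet_Ioi fun t ht ↦ ?_
    have e : ∀ u : I, g (t * u, t * (1 - u)) = (fun s ↦ g (s, t - s)) (t * u) := fun u ↦ by
      simp only [mul_sub, mul_one]
    simp_rw [e]
    exact lintegral_unitInterval_mul ht (hg.comp (measurable_id.prodMk (measurable_const.sub measurable_id)))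
  rw [step1]
  -- the integrand on the triangle `0 < s < t`, as a function on `ℝ × ℝ`
  set F : ℝ × ℝ → ℝ≥0∞ := {p : ℝ × ℝ | 0 < p.2 ∧ p.2 < p.1}.indicator (fun p ↦ g (p.2, p.1 - p.2))
    with hFdef
  have hFm : Measurable F := by
    refine Measurable.indicator (hg.comp (measurable_snd.prodMk (measurable_fst.sub measurable_snd))) ?_
    exact (measurableSet_lt measurable_const measurable_snd).inter
      (measurableSet_lt measurable_snd measurable_fst)
  -- left-hand side as a double integral of `F`
  have hL : ∫⁻ t in Ioi (0 : ℝ), ∫⁻ s in Ioo (0 : ℝ) t, g (s, t - s) = ∫⁻ t, ∫⁻ s, F (t, s) := by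
    rw [← lintegral_indicator measurableSet_Ioi]
    refine lintegral_congr fun t ↦ ?_
    by_cases ht : 0 < t
    · rw [indicator_of_mem (show t ∈ Ioi (0 : ℝ) from ht), ← lintegral_indicator measurableSet_Ioo]
      refine lintegral_congr fun s ↦ ?_
      simp only [hFdef, indicator, mem_Ioo, mem_setOf_eq]
    · rw [indicator_of_notMem (show t ∉ Ioi (0 : ℝ) from ht)]
      have h0 : ∀ s, F (t, s) = 0 := fun s ↦ by
        simp only [hFdef]
        exact indicator_of_notMem (fun h ↦ ht (h.1.trans h.2)) _
      simp only [h0, lintegral_zero]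
  -- right-hand side as the swapped double integral of `F`
  have hR : ∫⁻ s in Ioi (0 : ℝ), ∫⁻ s' in Ioi (0 : ℝ), g (s, s') = ∫⁻ s, ∫⁻ t, F (t, s) := by
    rw [← lintegral_indicator measurableSet_Ioi]
    refine lintegral_congr fun s ↦ ?_
    by_cases hs : 0 < s
    · rw [indicator_of_mem (show s ∈ Ioi (0 : ℝ) from hs), ← lintegral_indicator measurableSet_Ioi,
        ← lintegral_add_right_eq_self (fun t ↦ F (t, s)) s]
      refine lintegral_congr fun t ↦ ?_
      simp only [hFdef, indicator, mem_Ioi, mem_setOf_eq, add_sub_cancel_right, hs, true_and,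
        lt_add_iff_pos_left]
    · rw [indicator_of_notMem (show s ∉ Ioi (0 : ℝ) from hs)]
      have h0 : ∀ t, F (t, s) = 0 := fun t ↦ by
        simp only [hFdef]
        exact indicator_of_notMem (fun h ↦ hs h.1) _
      simp only [h0, lintegral_zero]
  rw [hL, hR]
  exact lintegral_lintegral_swap (hFm.comp measurable_id).aemeasurable

end BrownianLoop

end Literature.Probability.RandomPlanarGeometry

end
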